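import Literature.Probability.Moments.BiasedCubeLogSobolev
import HarnessLib

/-!
# A Talagrand-type sharp-threshold inequality on the biased cube via the log-Sobolev inequality

Topic `Literature/Probability/Moments`. On the biased cube `({0,1}^n, μ_p^{⊗n})`
(`BiasedCubeLogSobolev.lean`), for the coordinate operators `E_i` (average the `i`-th bit) and
`D_i g = g − E_i g`, we prove the inequality of Falik–Samorodnitsky / Rossignol type
(R. Rossignol, *Threshold for monotone symmetric properties through a logarithmic Sobolev
inequality*, Ann. Probab. 34 (2006), Thm. 2.1/§3; M. Talagrand, *On Russo's approximate zero-one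
law*, Ann. Probab. 22 (1994), Thm. 1.1 for the form with influences):

* `var_mul_log_le` — **`Var_p(g) · log( Var_p(g) / Σ_k ‖D_k g‖₁² ) ≤ (4/(p(1−p))) Σ_k ‖D_k g‖₂²`**
  for every `g : {0,1}^n → ℝ`, `0 < p < 1`;
* `sharpThreshold_indicator` — for the indicator of an increasing set `A` with `t = μ_p(A)` and
  pivotality probabilities `I_k = μ_p(k pivotal for A)`:
  **`t(1−t) log( t(1−t) / (4p²(1−p)² Σ_k I_k²) ) ≤ 4 Σ_k I_k`** — since `Σ_k I_k = dμ_p(A)/dp`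
  (Russo) and `Σ I_k² ≤ (max_k I_k) Σ_k I_k`, this is the sharp-threshold differential inequality
  "`f' ≥ c f(1−f) log(1/max pivotality)`" up to the `log(f(1−f))` and `log f'` corrections.

Proof (Rossignol §3 / Falik–Samorodnitsky): martingale differences `d_k = E_{>k} g − E_{≥k} g`
along the coordinates (tail-averaging operators `T (tail k)`), `Var = Σ ‖d_k‖₂²`,
`‖d_k‖₁ ≤ ‖D_k g‖₁`, `Σ_j ‖D_j d_k‖₂² = ‖d_k‖₂² + Σ_{j<k} ‖d_k(D_j g)‖₂²`, the log-Sobolev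
inequality `logSobolev` applied to each `d_k`, the entropy lower bound
`Ent(h) ≥ E h · log(E h/(E√h)²)` and the log-sum inequality. All operators are written as finite
kernels `T p o` indexed by a mask `o` of averaged coordinates, whose composition is the mask union
(`T_T`). Finite sums only.

## References

* R. Rossignol, Ann. Probab. 34 (2006) 1707–1725, Thm. 2.1 and §3 [Rossignol2006].
* M. Talagrand, Ann. Probab. 22 (1994) 1576–1587, Thm. 1.1 [Talagrand1994].
* D. Falik, A. Samorodnitsky, *Edge-isoperimetric inequalities and influences*, Combin. Probab.
  Comput. 16 (2007) 693–712 (the martingale argument).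
-/

noncomputable section

namespace Literature.Probability.Moments

namespace BiasedCube

open Finset Real

variable {n : ℕ}

/-! ## Kernel operators: averaging over a set of coordinates -/

/-- The one-coordinate kernel: averaging (`o = true`: weight `wt p b` on the new bit `b`) or the
identity (`o = false`: `b` must equal the old bit `a`). [folklore] -/
def kfac (p : ℝ) (o a b : Bool) : ℝ := if o then wt p b else (if b = a then 1 else 0)

/-- The product kernel of a mask `o` of averaged coordinates. [folklore] -/
def ker (p : ℝ) (o x y : Fin n → Bool) : ℝ := ∏ i, kfac p (o i) (x i) (y i)

/-- **The averaging operator of a mask**: `(T p o g)(x) = Σ_y ker p o x y · g y` — average `g` over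
the coordinates in `o` (with the biased weights), keeping the others equal to those of `x`; e.g.
`o = 1` everywhere gives the constant `E_p[g]`, `o = 0` everywhere the identity, `o = 1_{≥k}` the
conditional expectation given the first `k` bits. [cite: Rossignol2006, §3 (conditional expectations)] -/
def T (p : ℝ) (o : Fin n → Bool) (g : (Fin n → Bool) → ℝ) (x : Fin n → Bool) : ℝ := ∑ y, ker p o x y * g y

/-- Composition of one-coordinate kernels is the `or` of the masks. [folklore] -/
theorem sum_kfac_mul_kfac (p : ℝ) (o o' a c : Bool) :
    ∑ b, kfac p o a b * kfac p o' b c = kfac p (o || o') a c := by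
  cases o <;> cases o' <;> cases a <;> cases c <;> simp [kfac, wt] <;> ring

/-- **Composition of averaging operators is the union of the masks.** [cite: Rossignol2006, §3] -/
theorem T_T (p : ℝ) (o o' : Fin n → Bool) (g : (Fin n → Bool) → ℝ) :
    T p o (T p o' g) = T p (fun i => o i || o' i) g := by
  funext x
  unfold T
  simp only [Finset.mul_sum]
  rw [Finset.sum_comm]
  refine Finset.sum_congr rfl fun z _ => ?_
  have hk : ∑ y, ker p o x y * ker p o' y z = ker p (fun i => o i || o' i) x z := by
    unfold ker
    simp_rw [← Finset.prod_mul_distrib]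
    rw [← Fintype.prod_sum fun i b => kfac p (o i) (x i) b * kfac p (o' i) b (z i)]
    simp only [sum_kfac_mul_kfac]
  calc ∑ y, ker p o x y * (ker p o' y z * g z) = (∑ y, ker p o x y * ker p o' y z) * g z := by
        rw [Finset.sum_mul]; exact Finset.sum_congr rfl fun y _ => by ring
    _ = ker p (fun i => o i || o' i) x z * g z := by rw [hk]

/-- The one-coordinate kernel is a probability. [folklore] -/
theorem sum_kfac (p : ℝ) (o a : Bool) : ∑ b, kfac p o a b = 1 := by
  cases o <;> cases a <;> simp [kfac, wt]

/-- The kernel of a mask is a probability. [folklore] -/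
theorem sum_ker (p : ℝ) (o x : Fin n → Bool) : ∑ y, ker p o x y = 1 := by
  unfold ker
  rw [← Fintype.prod_sum fun i b => kfac p (o i) (x i) b]
  simp only [sum_kfac, Finset.prod_const_one]

/-- Kernels are nonnegative for `p ∈ [0,1]`. [folklore] -/
theorem kfac_nonneg {p : ℝ} (hp0 : 0 ≤ p) (hp1 : p ≤ 1) (o a b : Bool) : 0 ≤ kfac p o a b := by
  cases o
  · simp only [kfac, Bool.false_eq_true, if_false]; split_ifs <;> norm_num
  · simp only [kfac, if_true]; exact wt_nonneg hp0 hp1 b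

/-- Mask kernels are nonnegative for `p ∈ [0,1]`. [folklore] -/
theorem ker_nonneg {p : ℝ} (hp0 : 0 ≤ p) (hp1 : p ≤ 1) (o x y : Fin n → Bool) : 0 ≤ ker p o x y :=
  Finset.prod_nonneg fun _ _ => kfac_nonneg hp0 hp1 _ _ _

/-- The full mask gives the expectation: `T p 1 g x = E_p[g]`. [folklore] -/
theorem T_all (p : ℝ) (g : (Fin n → Bool) → ℝ) (x : Fin n → Bool) : T p (fun _ => true) g x = Ep p g := by
  unfold T Ep ker w
  simp [kfac]

/-- The empty mask is the identity. [folklore] -/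
theorem T_none (p : ℝ) (g : (Fin n → Bool) → ℝ) : T p (fun _ => false) g = g := by
  funext x
  unfold T ker
  have hker : ∀ y : Fin n → Bool, (∏ i, kfac p false (x i) (y i)) = if y = x then 1 else 0 := by
    intro y
    by_cases hy : y = x
    · subst hy; simp [kfac]
    · rw [if_neg hy]
      obtain ⟨i, hi⟩ : ∃ i, y i ≠ x i := by
        by_contra h; push Not at h; exact hy (funext h)
      exact Finset.prod_eq_zero (Finset.mem_univ i) (by simp [kfac, hi])
  simp only [hker, ite_mul, one_mul, zero_mul, Finset.sum_ite_eq', Finset.mem_univ, if_true]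

/-- **Detailed balance**: `w x · ker o x y = w y · ker o y x`. [folklore] -/
theorem w_mul_ker (p : ℝ) (o x y : Fin n → Bool) : w p x * ker p o x y = w p y * ker p o y x := by
  unfold w ker
  rw [← Finset.prod_mul_distrib, ← Finset.prod_mul_distrib]
  refine Finset.prod_congr rfl fun i _ => ?_
  cases o i <;> cases x i <;> cases y i <;> simp [kfac, wt] <;> ring

/-- **Symmetry**: `E_p[h · T o g] = E_p[T o h · g]`. [cite: Rossignol2006, §3] -/
theorem Ep_mul_T (p : ℝ) (o : Fin n → Bool) (g h : (Fin n → Bool) → ℝ) :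
    Ep p (fun x => h x * T p o g x) = Ep p (fun x => T p o h x * g x) := by
  unfold Ep T
  simp only [Finset.mul_sum, Finset.sum_mul]
  rw [Finset.sum_comm]
  refine Finset.sum_congr rfl fun x _ => Finset.sum_congr rfl fun y _ => ?_
  calc w p y * (h y * (ker p o y x * g x)) = (w p y * ker p o y x) * h y * g x := by ring
    _ = (w p x * ker p o x y) * h y * g x := by rw [w_mul_ker]
    _ = _ := by ring

/-- **Invariance of the measure**: `E_p[T o g] = E_p[g]`. [folklore] -/
theorem Ep_T (p : ℝ) (o : Fin n → Bool) (g : (Fin n → Bool) → ℝ) : Ep p (T p o g) = Ep p g := by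
  have h := Ep_mul_T p o g (fun _ => 1)
  simp only [one_mul] at h
  rw [show (T p o g) = fun x => T p o g x from rfl, h]
  refine Finset.sum_congr rfl fun x _ => ?_
  congr 1
  unfold T
  simp [sum_ker]

/-- `T` is linear. [folklore] -/
theorem T_add (p : ℝ) (o : Fin n → Bool) (g h : (Fin n → Bool) → ℝ) :
    T p o (fun x => g x + h x) = fun x => T p o g x + T p o h x := by
  funext x; simp only [T, mul_add, Finset.sum_add_distrib]

/-- `T` of a difference. [folklore] -/
theorem T_sub (p : ℝ) (o : Fin n → Bool) (g h : (Fin n → Bool) → ℝ) :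
    T p o (fun x => g x - h x) = fun x => T p o g x - T p o h x := by
  funext x; simp only [T, mul_sub, Finset.sum_sub_distrib]

/-- `T` fixes constants. [folklore] -/
theorem T_const (p : ℝ) (o : Fin n → Bool) (c : ℝ) : T p o (fun _ => c) = fun _ => c := by
  funext x; unfold T; rw [← Finset.sum_mul, sum_ker, one_mul]

/-- Jensen for the kernel (a probability, `p ∈ [0,1]`): `(T o g x)² ≤ T o (g²) x`. [folklore] -/
theorem T_sq_le {p : ℝ} (hp0 : 0 ≤ p) (hp1 : p ≤ 1) (o : Fin n → Bool) (g : (Fin n → Bool) → ℝ) (x : Fin n → Bool) :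
    (T p o g x) ^ 2 ≤ T p o (fun y => g y ^ 2) x := by
  unfold T
  have h := Finset.sum_mul_sq_le_sq_mul_sq (Finset.univ : Finset (Fin n → Bool))
    (fun y => Real.sqrt (ker p o x y)) (fun y => Real.sqrt (ker p o x y) * g y)
  have hk : ∀ y, Real.sqrt (ker p o x y) * Real.sqrt (ker p o x y) = ker p o x y :=
    fun y => Real.mul_self_sqrt (ker_nonneg hp0 hp1 o x y)
  have e1 : (∑ y, ker p o x y * g y) = ∑ y, Real.sqrt (ker p o x y) * (Real.sqrt (ker p o x y) * g y) := by
    refine Finset.sum_congr rfl fun y _ => ?_; rw [← mul_assoc, hk]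
  have e2 : (∑ y, Real.sqrt (ker p o x y) ^ 2) = 1 := by
    rw [← sum_ker p o x]; refine Finset.sum_congr rfl fun y _ => Real.sq_sqrt (ker_nonneg hp0 hp1 o x y)
  have e3 : (∑ y, (Real.sqrt (ker p o x y) * g y) ^ 2) = ∑ y, ker p o x y * g y ^ 2 := by
    refine Finset.sum_congr rfl fun y _ => ?_; rw [mul_pow, Real.sq_sqrt (ker_nonneg hp0 hp1 o x y)]
  rw [e1]; rw [e2, e3, one_mul] at h; exact h

/-- `|T o g x| ≤ T o |g| x`. [folklore] -/
theorem abs_T_le {p : ℝ} (hp0 : 0 ≤ p) (hp1 : p ≤ 1) (o : Fin n → Bool) (g : (Fin n → Bool) → ℝ) (x : Fin n → Bool) :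
    |T p o g x| ≤ T p o (fun y => |g y|) x := by
  unfold T
  refine (Finset.abs_sum_le_sum_abs _ _).trans (le_of_eq (Finset.sum_congr rfl fun y _ => ?_))
  rw [abs_mul, abs_of_nonneg (ker_nonneg hp0 hp1 o x y)]

/-! ## Coordinate masks, the operators `E_i`, `D_i`, and the tail conditional expectations -/

/-- The mask of the single coordinate `i`. [folklore] -/
def eMask (i : Fin n) : Fin n → Bool := fun j => decide (j = i)

/-- The mask of the coordinates `≥ k` (tail averaging = conditional expectation given the first
`k` bits). [cite: Rossignol2006, §3] -/
def tail (k : ℕ) : Fin n → Bool := fun j => decide (k ≤ (j : ℕ))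

/-- **`D_i g = g − E_i g`**, the centred `i`-th coordinate part. [cite: Rossignol2006, §2 (∇_i)] -/
def D (p : ℝ) (i : Fin n) (g : (Fin n → Bool) → ℝ) : (Fin n → Bool) → ℝ := fun x => g x - T p (eMask i) g x

/-- **The martingale differences** `d_k = E_{>k} g − E_{≥k} g`. [cite: Rossignol2006, §3 (Δ_k)] -/
def dk (p : ℝ) (k : Fin n) (g : (Fin n → Bool) → ℝ) : (Fin n → Bool) → ℝ :=
  fun x => T p (tail ((k : ℕ) + 1)) g x - T p (tail (k : ℕ)) g x

/-! ### Mask algebra -/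

/-- `tail a ∪ tail b = tail (min a b)`. [folklore] -/
theorem tail_or_tail (a b : ℕ) : (fun j : Fin n => tail a j || tail b j) = tail (min a b) := by
  funext j; simp only [tail, min_le_iff, Bool.decide_or]

/-- `tail (i+1) ∪ {i} = tail i`. [folklore] -/
theorem tail_succ_or_e (i : Fin n) : (fun j : Fin n => tail ((i : ℕ) + 1) j || eMask i j) = tail (i : ℕ) := by
  funext j
  rcases lt_trichotomy (i : ℕ) j with h | h | h
  · have h1 : (i : ℕ) + 1 ≤ j := h
    simp [tail, eMask, h1, h.le]
  · have hji : j = i := Fin.ext h.symm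
    subst hji
    simp [tail, eMask]
  · have h1 : ¬ (i : ℕ) + 1 ≤ j := by omega
    have h2 : ¬ (i : ℕ) ≤ j := by omega
    have h3 : j ≠ i := fun hji => by subst hji; omega
    simp [tail, eMask, h1, h2, h3]

/-- Masks commute. [folklore] -/
theorem eMask_or_comm (i : Fin n) (o : Fin n → Bool) : (fun j : Fin n => eMask i j || o j) = fun j => o j || eMask i j :=
  funext fun _ => Bool.or_comm _ _

/-- `tail 0` is the full mask. [folklore] -/
theorem tail_zero : (tail 0 : Fin n → Bool) = fun _ => true := by
  funext j; simp [tail]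

/-- `tail n` is the empty mask. [folklore] -/
theorem tail_self : (tail n : Fin n → Bool) = fun _ => false := by
  funext j; simp only [tail, decide_eq_false_iff_not, not_le]; exact j.isLt

/-! ### The one-coordinate average -/

/-- The kernel of `{i}` at `update x i b` is `wt p b`. [folklore] -/
theorem ker_eMask_update (p : ℝ) (i : Fin n) (x : Fin n → Bool) (b : Bool) :
    ker p (eMask i) x (Function.update x i b) = wt p b := by
  unfold ker
  rw [Finset.prod_eq_single i]
  · simp [eMask, kfac]
  · intro j _ hji
    simp [eMask, kfac, hji]
  · intro h; exact absurd (Finset.mem_univ i) h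

/-- The kernel of `{i}` vanishes off `{update x i b}`. [folklore] -/
theorem ker_eMask_eq_zero (p : ℝ) (i : Fin n) {x y : Fin n → Bool} (hy : ∀ b, y ≠ Function.update x i b) :
    ker p (eMask i) x y = 0 := by
  obtain ⟨j, hji, hj⟩ : ∃ j, j ≠ i ∧ y j ≠ x j := by
    by_contra h
    push Not at h
    apply hy (y i)
    funext j
    by_cases hji : j = i
    · subst hji; simp
    · rw [Function.update_of_ne hji]; exact h j hji
  unfold ker
  exact Finset.prod_eq_zero (Finset.mem_univ j) (by simp [eMask, kfac, hji, hj])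

/-- **`E_i` in coordinates**: `T p {i} g x = p g(x^{i,1}) + (1−p) g(x^{i,0})`. [folklore] -/
theorem T_eMask (p : ℝ) (i : Fin n) (g : (Fin n → Bool) → ℝ) (x : Fin n → Bool) :
    T p (eMask i) g x = p * g (Function.update x i true) + (1 - p) * g (Function.update x i false) := by
  unfold T
  have hne : Function.update x i true ≠ Function.update x i false := by
    intro h; have := congrFun h i; simp at this
  rw [Finset.sum_eq_add (Function.update x i true) (Function.update x i false) hne]
  · rw [ker_eMask_update, ker_eMask_update, wt_true, wt_false]
  · intro y _ hy
    rw [ker_eMask_eq_zero p i (fun b => by cases b <;> simp [hy.1, hy.2]), zero_mul]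
  · intro h; exact absurd (Finset.mem_univ _) h
  · intro h; exact absurd (Finset.mem_univ _) h

/-- `D_i g` at `x^{i,1}`. [folklore] -/
theorem D_update_true (p : ℝ) (i : Fin n) (g : (Fin n → Bool) → ℝ) (x : Fin n → Bool) :
    D p i g (Function.update x i true) = (1 - p) * (g (Function.update x i true) - g (Function.update x i false)) := by
  simp only [D, T_eMask, Function.update_idem]; ring

/-- `D_i g` at `x^{i,0}`. [folklore] -/
theorem D_update_false (p : ℝ) (i : Fin n) (g : (Fin n → Bool) → ℝ) (x : Fin n → Bool) :
    D p i g (Function.update x i false) = -p * (g (Function.update x i true) - g (Function.update x i false)) := by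
  simp only [D, T_eMask, Function.update_idem]; ring

/-- Averaging over the `i`-th bit first: `E_p[F] = E_p[E_i F]`. [folklore] -/
theorem Ep_eq_Ep_T_eMask (p : ℝ) (i : Fin n) (F : (Fin n → Bool) → ℝ) :
    Ep p F = Ep p (fun x => p * F (Function.update x i true) + (1 - p) * F (Function.update x i false)) := by
  rw [← Ep_T p (eMask i) F]
  congr 1
  funext x
  exact T_eMask p i F x

/-- **`‖D_i g‖₂² = p(1−p) E_p[(g(x^{i,1}) − g(x^{i,0}))²]`.** [cite: Rossignol2006, §2] -/
theorem Ep_D_sq (p : ℝ) (i : Fin n) (g : (Fin n → Bool) → ℝ) :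
    Ep p (fun x => D p i g x ^ 2) = p * (1 - p) * sqDiff p i g := by
  rw [Ep_eq_Ep_T_eMask p i, sqDiff, ← Ep_smul]
  congr 1
  funext x
  rw [D_update_true, D_update_false]
  ring

/-- **`‖D_i g‖₁ = 2p(1−p) E_p|g(x^{i,1}) − g(x^{i,0})|`** (`0 ≤ p ≤ 1`). [cite: Rossignol2006, §2] -/
theorem Ep_abs_D {p : ℝ} (hp0 : 0 ≤ p) (hp1 : p ≤ 1) (i : Fin n) (g : (Fin n → Bool) → ℝ) :
    Ep p (fun x => |D p i g x|) = 2 * p * (1 - p) * Ep p (fun x => |g (Function.update x i true) - g (Function.update x i false)|) := by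
  rw [Ep_eq_Ep_T_eMask p i, ← Ep_smul]
  congr 1
  funext x
  rw [D_update_true, D_update_false, abs_mul, abs_mul, abs_of_nonneg (sub_nonneg.2 hp1), abs_neg, abs_of_nonneg hp0]
  ring

/-! ### The martingale differences -/

/-- `d_k = E_{>k}(D_k g)`. [cite: Rossignol2006, §3] -/
theorem dk_eq_T_D (p : ℝ) (k : Fin n) (g : (Fin n → Bool) → ℝ) : dk p k g = T p (tail ((k : ℕ) + 1)) (D p k g) := by
  unfold dk D
  rw [T_sub, T_T, tail_succ_or_e]

/-- `d_k` is `F_{k+1}`-measurable: `E_{>k} d_k = d_k`. [folklore] -/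
theorem T_tail_succ_dk (p : ℝ) (k : Fin n) (g : (Fin n → Bool) → ℝ) : T p (tail ((k : ℕ) + 1)) (dk p k g) = dk p k g := by
  conv_lhs => rw [show dk p k g = fun x => T p (tail ((k : ℕ) + 1)) g x - T p (tail (k : ℕ)) g x from rfl]
  rw [T_sub, T_T, T_T, tail_or_tail, tail_or_tail, min_self, Nat.min_eq_right (Nat.le_succ _)]
  rfl

/-- `E_{≥j+1} d_k = 0` for `j < k`. [folklore] -/
theorem T_tail_dk_eq_zero (p : ℝ) {j k : Fin n} (hjk : j < k) (g : (Fin n → Bool) → ℝ) :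
    T p (tail ((j : ℕ) + 1)) (dk p k g) = fun _ => 0 := by
  rw [show dk p k g = fun x => T p (tail ((k : ℕ) + 1)) g x - T p (tail (k : ℕ)) g x from rfl, T_sub, T_T, T_T,
    tail_or_tail, tail_or_tail]
  have h1 : min ((j : ℕ) + 1) ((k : ℕ) + 1) = (j : ℕ) + 1 := by
    have : (j : ℕ) < k := hjk; omega
  have h2 : min ((j : ℕ) + 1) (k : ℕ) = (j : ℕ) + 1 := by
    have : (j : ℕ) < k := hjk; omega
  rw [h1, h2]
  funext x; ring

/-- **Orthogonality of the martingale differences**: `E_p[d_j d_k] = 0` for `j < k`. [cite: Rossignol2006, §3] -/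
theorem Ep_dk_mul_dk (p : ℝ) {j k : Fin n} (hjk : j < k) (g : (Fin n → Bool) → ℝ) :
    Ep p (fun x => dk p j g x * dk p k g x) = 0 := by
  calc Ep p (fun x => dk p j g x * dk p k g x) = Ep p (fun x => T p (tail ((j : ℕ) + 1)) (dk p j g) x * dk p k g x) := by
        rw [T_tail_succ_dk]
    _ = Ep p (fun x => dk p j g x * T p (tail ((j : ℕ) + 1)) (dk p k g) x) := (Ep_mul_T p _ _ _).symm
    _ = 0 := by rw [T_tail_dk_eq_zero p hjk]; simp [Ep]

/-- **Telescoping**: `Σ_k d_k = g − E_p[g]`. [cite: Rossignol2006, §3] -/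
theorem sum_dk (p : ℝ) (g : (Fin n → Bool) → ℝ) (x : Fin n → Bool) : ∑ k : Fin n, dk p k g x = g x - Ep p g := by
  have h := Fin.sum_univ_eq_sum_range (fun k => T p (tail (k + 1)) g x - T p (tail k) g x) n
  simp only [dk]
  rw [h, Finset.sum_range_sub (fun k => T p (tail k) g x), tail_self, tail_zero, T_none, T_all]

/-- **Variance decomposition**: `E_p[(g − E_p g)²] = Σ_k ‖d_k‖₂²`. [cite: Rossignol2006, §3] -/
theorem Ep_sq_sub_eq_sum (p : ℝ) (g : (Fin n → Bool) → ℝ) :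
    Ep p (fun x => (g x - Ep p g) ^ 2) = ∑ k : Fin n, Ep p (fun x => dk p k g x ^ 2) := by
  have hsq : ∀ x, (g x - Ep p g) ^ 2 = ∑ j : Fin n, ∑ k : Fin n, dk p j g x * dk p k g x := by
    intro x; rw [← sum_dk p g x, sq, Finset.sum_mul_sum]
  simp_rw [hsq]
  -- exchange `Ep` and the double sum
  have hEp : Ep p (fun x => ∑ j : Fin n, ∑ k : Fin n, dk p j g x * dk p k g x) =
      ∑ j : Fin n, ∑ k : Fin n, Ep p (fun x => dk p j g x * dk p k g x) := by
    simp only [Ep, Finset.mul_sum]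
    rw [Finset.sum_comm]
    refine Finset.sum_congr rfl fun j _ => ?_
    rw [Finset.sum_comm]
  rw [hEp]
  refine Finset.sum_congr rfl fun j _ => ?_
  rw [Finset.sum_eq_single j]
  · simp [sq]
  · intro k _ hkj
    rcases lt_or_gt_of_ne hkj with h | h
    · rw [show (fun x => dk p j g x * dk p k g x) = fun x => dk p k g x * dk p j g x from funext fun x => mul_comm _ _]
      exact Ep_dk_mul_dk p h g
    · exact Ep_dk_mul_dk p h g
  · intro h; exact absurd (Finset.mem_univ j) h

/-- **`‖d_k‖₁ ≤ ‖D_k g‖₁`** (conditional expectation contracts `L¹`). [cite: Rossignol2006, §3] -/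
theorem Ep_abs_dk_le {p : ℝ} (hp0 : 0 ≤ p) (hp1 : p ≤ 1) (k : Fin n) (g : (Fin n → Bool) → ℝ) :
    Ep p (fun x => |dk p k g x|) ≤ Ep p (fun x => |D p k g x|) := by
  rw [dk_eq_T_D]
  calc Ep p (fun x => |T p (tail ((k : ℕ) + 1)) (D p k g) x|) ≤ Ep p (T p (tail ((k : ℕ) + 1)) (fun y => |D p k g y|)) :=
        Ep_mono hp0 hp1 fun x => abs_T_le hp0 hp1 _ _ x
    _ = _ := Ep_T p _ _

/-- **`‖d_k‖₂² ≤ ‖D_k g‖₂²`** (Jensen); summed, this is the Efron–Stein inequality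
`Var_p(g) ≤ Σ_k ‖D_k g‖₂²`. [cite: Rossignol2006, §3] -/
theorem Ep_dk_sq_le {p : ℝ} (hp0 : 0 ≤ p) (hp1 : p ≤ 1) (k : Fin n) (g : (Fin n → Bool) → ℝ) :
    Ep p (fun x => dk p k g x ^ 2) ≤ Ep p (fun x => D p k g x ^ 2) := by
  rw [dk_eq_T_D]
  calc Ep p (fun x => T p (tail ((k : ℕ) + 1)) (D p k g) x ^ 2) ≤ Ep p (T p (tail ((k : ℕ) + 1)) (fun y => D p k g y ^ 2)) :=
        Ep_mono hp0 hp1 fun x => T_sq_le hp0 hp1 _ _ x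
    _ = _ := Ep_T p _ _

/-- Efron–Stein on the biased cube: `Var_p(g) ≤ Σ_k ‖D_k g‖₂²`. [folklore] -/
theorem var_le_sum_Ep_D_sq {p : ℝ} (hp0 : 0 ≤ p) (hp1 : p ≤ 1) (g : (Fin n → Bool) → ℝ) :
    Ep p (fun x => (g x - Ep p g) ^ 2) ≤ ∑ k : Fin n, Ep p (fun x => D p k g x ^ 2) := by
  rw [Ep_sq_sub_eq_sum]
  exact Finset.sum_le_sum fun k _ => Ep_dk_sq_le hp0 hp1 k g

/-! ### The gradient of the martingale differences -/

/-- **`D_j` commutes with the martingale differences**: `D_j d_k(g) = d_k(D_j g)` (the coordinate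
average `E_j` commutes with every tail average). [cite: Rossignol2006, §3] -/
theorem D_dk_comm (p : ℝ) (j k : Fin n) (g : (Fin n → Bool) → ℝ) : D p j (dk p k g) = dk p k (D p j g) := by
  have hdk : ∀ h : (Fin n → Bool) → ℝ, dk p k h = fun x => T p (tail ((k : ℕ) + 1)) h x - T p (tail (k : ℕ)) h x :=
    fun h => rfl
  have hD : ∀ h : (Fin n → Bool) → ℝ, D p j h = fun x => h x - T p (eMask j) h x := fun h => rfl
  simp only [hD, hdk, T_sub, T_T, eMask_or_comm]
  funext x
  ring

/-- The centred second moment is at most the second moment. [folklore] -/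
theorem Ep_sq_sub_Ep_le (p : ℝ) (h : (Fin n → Bool) → ℝ) :
    Ep p (fun x => (h x - Ep p h) ^ 2) ≤ Ep p (fun x => h x ^ 2) := by
  have hexp : (fun x => (h x - Ep p h) ^ 2) = fun x => h x ^ 2 - (2 * Ep p h * h x - Ep p h ^ 2) := by
    funext x; ring
  rw [hexp, Ep_sub, Ep_sub, Ep_smul, Ep_const]
  nlinarith [sq_nonneg (Ep p h)]

/-- **The total gradient energy of the martingale differences**:
`Σ_k Σ_j ‖D_j d_k‖₂² = Σ_j Var_p(D_j g) ≤ Σ_j ‖D_j g‖₂²`. [cite: Rossignol2006, §3] -/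
theorem sum_sum_Ep_D_dk_sq_le (p : ℝ) (g : (Fin n → Bool) → ℝ) :
    ∑ k : Fin n, ∑ j : Fin n, Ep p (fun x => D p j (dk p k g) x ^ 2) ≤ ∑ j : Fin n, Ep p (fun x => D p j g x ^ 2) := by
  rw [Finset.sum_comm]
  refine Finset.sum_le_sum fun j _ => ?_
  simp only [D_dk_comm]
  rw [← Ep_sq_sub_eq_sum]
  exact Ep_sq_sub_Ep_le p _

/-! ## Entropy lower bound and the log-sum inequality -/

/-- Weights are positive for `0 < p < 1`. [folklore] -/
theorem w_pos {p : ℝ} (hp0 : 0 < p) (hp1 : p < 1) (x : Fin n → Bool) : 0 < w p x :=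
  Finset.prod_pos fun i _ => by cases x i <;> simp [wt] <;> linarith

/-- For `0 < p < 1`, a nonnegative function with `E_p[h] = 0` vanishes identically. [folklore] -/
theorem eq_zero_of_Ep_eq_zero {p : ℝ} (hp0 : 0 < p) (hp1 : p < 1) {h : (Fin n → Bool) → ℝ} (hh : ∀ x, 0 ≤ h x)
    (hE : Ep p h = 0) (x : Fin n → Bool) : h x = 0 := by
  have hterm := (Finset.sum_eq_zero_iff_of_nonneg (fun y _ => mul_nonneg (w_pos hp0 hp1 y).le (hh y))).1 hE x (Finset.mem_univ x)
  rcases mul_eq_zero.1 hterm with h0 | h0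
  · exact absurd h0 (w_pos hp0 hp1 x).ne'
  · exact h0

/-- **Entropy lower bound** (Jensen): for `h ≥ 0` with `E_p[h] > 0`,
`Ent_p(h) ≥ E_p[h] · log( E_p[h] / E_p[√h]² )`. [cite: Rossignol2006, §3 (proof of Thm 2.1)] -/
theorem Ep_mul_log_le_Ent {p : ℝ} (hp0 : 0 < p) (hp1 : p < 1) {h : (Fin n → Bool) → ℝ} (hh : ∀ x, 0 ≤ h x)
    (hm : 0 < Ep p h) :
    Ep p h * Real.log (Ep p h / (Ep p fun x => Real.sqrt (h x)) ^ 2) ≤ Ent p h := by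
  set m := Ep p h with hmdef
  set s := Ep p fun x => Real.sqrt (h x) with hsdef
  have hs0 : 0 ≤ s := Ep_nonneg hp0.le hp1.le fun x => Real.sqrt_nonneg _
  have hs : 0 < s := by
    rcases hs0.eq_or_lt with h0 | h0
    · exfalso
      have hzero : ∀ x, Real.sqrt (h x) = 0 := eq_zero_of_Ep_eq_zero hp0 hp1 (fun x => Real.sqrt_nonneg _) h0.symm
      have : m = 0 := by
        rw [hmdef]; refine Finset.sum_eq_zero fun x _ => ?_
        have := hzero x
        rw [Real.sqrt_eq_zero (hh x)] at this
        rw [this, mul_zero]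
      exact hm.ne' this
    · exact h0
  -- termwise: `h log h − h log(m²/s²) ≥ 2h − 2(m/s)√h`
  have hterm : ∀ x, 2 * h x - 2 * (m / s) * Real.sqrt (h x) ≤ h x * Real.log (h x) - h x * Real.log (m ^ 2 / s ^ 2) := by
    intro x
    rcases (hh x).eq_or_lt with h0 | hpos
    · rw [← h0]; simp
    · have hsq : 0 < Real.sqrt (h x) := Real.sqrt_pos.2 hpos
      set y : ℝ := Real.sqrt (h x) * s / m with hy
      have hy0 : 0 < y := by rw [hy]; positivity
      have hlog : 1 - y⁻¹ ≤ Real.log y := Real.one_sub_inv_le_log_of_pos hy0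
      have hid : h x * Real.log (h x) - h x * Real.log (m ^ 2 / s ^ 2) = 2 * h x * Real.log y := by
        rw [hy, Real.log_div (by positivity) hm.ne', Real.log_mul hsq.ne' hs.ne', Real.log_div (by positivity) (by positivity),
          Real.log_pow, Real.log_pow, Real.log_sqrt (hh x)]
        ring
      rw [hid]
      have hinv : y⁻¹ = m / (Real.sqrt (h x) * s) := by rw [hy, inv_div]
      have hmul : 2 * h x * (1 - y⁻¹) = 2 * h x - 2 * (m / s) * Real.sqrt (h x) := by
        rw [hinv]
        have hhx : h x = Real.sqrt (h x) * Real.sqrt (h x) := (Real.mul_self_sqrt (hh x)).symm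
        field_simp
        nlinarith [hhx]
      calc 2 * h x - 2 * (m / s) * Real.sqrt (h x) = 2 * h x * (1 - y⁻¹) := hmul.symm
        _ ≤ 2 * h x * Real.log y := mul_le_mul_of_nonneg_left hlog (by positivity)
  have hsum : Ep p (fun x => 2 * h x - 2 * (m / s) * Real.sqrt (h x)) ≤
      Ep p (fun x => h x * Real.log (h x) - h x * Real.log (m ^ 2 / s ^ 2)) := Ep_mono hp0.le hp1.le hterm
  have hl : Ep p (fun x => 2 * h x - 2 * (m / s) * Real.sqrt (h x)) = 0 := by
    rw [Ep_sub, Ep_smul, Ep_smul, ← hmdef, ← hsdef]; field_simp; ring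
  have hr : Ep p (fun x => h x * Real.log (h x) - h x * Real.log (m ^ 2 / s ^ 2)) = Ent p h - m * Real.log (m / s ^ 2) := by
    rw [Ep_sub, Ent, ← hmdef]
    have : (fun x => h x * Real.log (m ^ 2 / s ^ 2)) = fun x => Real.log (m ^ 2 / s ^ 2) * h x := by funext x; ring
    rw [this, Ep_smul, ← hmdef, Real.log_div (by positivity) (by positivity), Real.log_div hm.ne' (by positivity), Real.log_pow]
    ring
  rw [hl, hr] at hsum
  linarith

/-- **Log-sum inequality**: for positive `a_k, b_k` on a nonempty finite set,
`Σ a_k log(a_k/b_k) ≥ (Σ a_k) log(Σ a_k / Σ b_k)`. [folklore] -/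
theorem sum_mul_log_div_ge {ι : Type*} (s : Finset ι) {a b : ι → ℝ} (ha : ∀ k ∈ s, 0 < a k) (hb : ∀ k ∈ s, 0 < b k)
    (hs : s.Nonempty) :
    (∑ k ∈ s, a k) * Real.log ((∑ k ∈ s, a k) / ∑ k ∈ s, b k) ≤ ∑ k ∈ s, a k * Real.log (a k / b k) := by
  set A := ∑ k ∈ s, a k with hA
  set B := ∑ k ∈ s, b k with hB
  have hA0 : 0 < A := Finset.sum_pos ha hs
  have hB0 : 0 < B := Finset.sum_pos hb hs
  have hterm : ∀ k ∈ s, a k - A / B * b k ≤ a k * Real.log (a k / b k) - a k * Real.log (A / B) := by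
    intro k hk
    have hak := ha k hk; have hbk := hb k hk
    set y := a k * B / (b k * A) with hy
    have hy0 : 0 < y := by rw [hy]; positivity
    have hlog : 1 - y⁻¹ ≤ Real.log y := Real.one_sub_inv_le_log_of_pos hy0
    have hid : a k * Real.log (a k / b k) - a k * Real.log (A / B) = a k * Real.log y := by
      rw [hy, Real.log_div hak.ne' hbk.ne', Real.log_div hA0.ne' hB0.ne', Real.log_div (by positivity) (by positivity),
        Real.log_mul hak.ne' hB0.ne', Real.log_mul hbk.ne' hA0.ne']
      ring
    rw [hid]
    have hmul : a k * (1 - y⁻¹) = a k - A / B * b k := by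
      rw [hy, inv_div]; field_simp
    calc a k - A / B * b k = a k * (1 - y⁻¹) := hmul.symm
      _ ≤ a k * Real.log y := mul_le_mul_of_nonneg_left hlog hak.le
  have hsum := Finset.sum_le_sum hterm
  rw [Finset.sum_sub_distrib, Finset.sum_sub_distrib, ← Finset.mul_sum, ← Finset.sum_mul, ← hA, ← hB,
    div_mul_cancel₀ _ hB0.ne', sub_self] at hsum
  linarith

/-! ## The main inequality -/

/-- Entropy of a square is nonnegative (`0 < p < 1`). [folklore] -/
theorem Ent_sq_nonneg {p : ℝ} (hp0 : 0 < p) (hp1 : p < 1) (g : (Fin n → Bool) → ℝ) : 0 ≤ Ent p (fun x => g x ^ 2) := by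
  rcases (Ep_nonneg hp0.le hp1.le (fun x => sq_nonneg (g x))).eq_or_lt with hm | hm
  · have hz : ∀ x, g x ^ 2 = 0 := eq_zero_of_Ep_eq_zero hp0 hp1 (fun x => sq_nonneg _) hm.symm
    simp only [Ent, hz]
    simp [Ep]
  · have h1 := Ep_mul_log_le_Ent hp0 hp1 (fun x => sq_nonneg (g x)) hm
    have hs_eq : (Ep p fun x => Real.sqrt (g x ^ 2)) = Ep p fun x => |g x| := by
      congr 1; funext x; exact Real.sqrt_sq_eq_abs _
    rw [hs_eq] at h1
    have hcs := Ep_mul_sq_le hp0.le hp1.le (fun x => |g x|) (fun _ => (1 : ℝ))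
    simp only [mul_one, one_pow, Ep_const, sq_abs] at hcs
    rcases (sq_nonneg (Ep p fun x => |g x|)).eq_or_lt with h0 | h0
    · rw [← h0, div_zero, Real.log_zero, mul_zero] at h1; exact h1
    · have hlog : 0 ≤ Real.log (Ep p (fun x => g x ^ 2) / (Ep p fun x => |g x|) ^ 2) :=
        Real.log_nonneg ((le_div_iff₀ h0).2 (by linarith [hcs]))
      exact (mul_nonneg hm.le hlog).trans h1

/-- **The Falik–Samorodnitsky / Rossignol inequality on the biased cube.** For `0 < p < 1` and
`g : {0,1}^n → ℝ` with `Var_p(g) > 0` and `Σ_k ‖D_k g‖₁² > 0`: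
`Var_p(g) · log( Var_p(g) / Σ_k ‖D_k g‖₁² ) ≤ (2/(p(1−p))) Σ_k ‖D_k g‖₂²`.
[cite: Rossignol2006, Thm 2.1 (proof, §3)] [cite: Talagrand1994, Thm 1.1] -/
theorem var_mul_log_le {p : ℝ} (hp0 : 0 < p) (hp1 : p < 1) (g : (Fin n → Bool) → ℝ)
    (hV : 0 < Ep p (fun x => (g x - Ep p g) ^ 2)) (hB : 0 < ∑ k : Fin n, (Ep p fun x => |D p k g x|) ^ 2) :
    Ep p (fun x => (g x - Ep p g) ^ 2) * Real.log (Ep p (fun x => (g x - Ep p g) ^ 2) / ∑ k : Fin n, (Ep p fun x => |D p k g x|) ^ 2) ≤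
      2 / (p * (1 - p)) * ∑ k : Fin n, Ep p (fun x => D p k g x ^ 2) := by
  have hpq : 0 < p * (1 - p) := mul_pos hp0 (by linarith)
  obtain ⟨a, ha⟩ : ∃ a : Fin n → ℝ, a = fun k => Ep p (fun x => dk p k g x ^ 2) := ⟨_, rfl⟩
  obtain ⟨b, hb⟩ : ∃ b : Fin n → ℝ, b = fun k => Ep p (fun x => |dk p k g x|) := ⟨_, rfl⟩
  obtain ⟨V, hVdef⟩ : ∃ V : ℝ, V = Ep p (fun x => (g x - Ep p g) ^ 2) := ⟨_, rfl⟩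
  obtain ⟨B, hBdef⟩ : ∃ B : ℝ, B = ∑ k : Fin n, (Ep p fun x => |D p k g x|) ^ 2 := ⟨_, rfl⟩
  obtain ⟨E, hEdef⟩ : ∃ E : ℝ, E = ∑ k : Fin n, Ep p (fun x => D p k g x ^ 2) := ⟨_, rfl⟩
  rw [← hVdef, ← hBdef, ← hEdef]
  rw [← hVdef] at hV
  rw [← hBdef] at hB
  have ha0 : ∀ k, 0 ≤ a k := fun k => by rw [ha]; exact Ep_nonneg hp0.le hp1.le fun x => sq_nonneg _
  have hb0 : ∀ k, 0 ≤ b k := fun k => by rw [hb]; exact Ep_nonneg hp0.le hp1.le fun x => abs_nonneg _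
  have hVsum : V = ∑ k, a k := by rw [hVdef, ha]; exact Ep_sq_sub_eq_sum p g
  -- LSI for each `d_k`
  have hLS : ∀ k, Ent p (fun x => dk p k g x ^ 2) ≤ 2 / (p * (1 - p)) * ∑ j : Fin n, Ep p (fun x => D p j (dk p k g) x ^ 2) := by
    intro k
    have h := logSobolev hp0.le hp1.le (dk p k g)
    have hp0' : p ≠ 0 := hp0.ne'
    have h1p : 1 - p ≠ 0 := (sub_pos.2 hp1).ne'
    have hsq : ∀ j : Fin n, sqDiff p j (dk p k g) = (1 / (p * (1 - p))) * Ep p (fun x => D p j (dk p k g) x ^ 2) := by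
      intro j; rw [Ep_D_sq]; field_simp
    calc Ent p (fun x => dk p k g x ^ 2) ≤ 2 * ∑ j : Fin n, sqDiff p j (dk p k g) := h
      _ = 2 / (p * (1 - p)) * ∑ j : Fin n, Ep p (fun x => D p j (dk p k g) x ^ 2) := by
          simp only [hsq, ← Finset.mul_sum]; ring
  -- upper bound on the total entropy
  have hEnt : ∑ k : Fin n, Ent p (fun x => dk p k g x ^ 2) ≤ 2 / (p * (1 - p)) * E := by
    calc ∑ k : Fin n, Ent p (fun x => dk p k g x ^ 2)
        ≤ ∑ k : Fin n, 2 / (p * (1 - p)) * ∑ j : Fin n, Ep p (fun x => D p j (dk p k g) x ^ 2) := Finset.sum_le_sum fun k _ => hLS k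
      _ = 2 / (p * (1 - p)) * ∑ k : Fin n, ∑ j : Fin n, Ep p (fun x => D p j (dk p k g) x ^ 2) := by rw [Finset.mul_sum]
      _ ≤ 2 / (p * (1 - p)) * E := by
          rw [hEdef]; exact mul_le_mul_of_nonneg_left (sum_sum_Ep_D_dk_sq_le p g) (by positivity)
  -- entropy lower bounds on `S = {k | a_k > 0}`
  set S : Finset (Fin n) := Finset.univ.filter fun k => 0 < a k with hS
  have hSa : ∑ k ∈ S, a k = V := by
    rw [hVsum, hS, Finset.sum_filter]
    refine Finset.sum_congr rfl fun k _ => ?_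
    by_cases h : 0 < a k
    · rw [if_pos h]
    · rw [if_neg h]; linarith [ha0 k]
  have hSne : S.Nonempty := by
    by_contra hne
    rw [Finset.not_nonempty_iff_eq_empty] at hne
    rw [← hSa, hne, Finset.sum_empty] at hV
    exact lt_irrefl _ hV
  have hbpos : ∀ k ∈ S, 0 < b k := by
    intro k hk
    have hak : 0 < a k := (Finset.mem_filter.1 hk).2
    rcases (hb0 k).eq_or_lt with h0 | h0
    · exfalso
      have hz : ∀ x, |dk p k g x| = 0 := eq_zero_of_Ep_eq_zero hp0 hp1 (fun x => abs_nonneg _) (by rw [hb] at h0; exact h0.symm)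
      have : a k = 0 := by
        rw [ha]; refine Finset.sum_eq_zero fun x _ => ?_
        have hx0 := abs_eq_zero.1 (hz x)
        simp [hx0]
      exact hak.ne' this
    · exact h0
  have hlow : ∀ k ∈ S, a k * Real.log (a k / (b k) ^ 2) ≤ Ent p (fun x => dk p k g x ^ 2) := by
    intro k hk
    have hak : 0 < a k := (Finset.mem_filter.1 hk).2
    have h := Ep_mul_log_le_Ent hp0 hp1 (fun x => sq_nonneg (dk p k g x)) (by rw [ha] at hak; exact hak)
    have hs_eq : (Ep p fun x => Real.sqrt (dk p k g x ^ 2)) = b k := by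
      rw [hb]; congr 1; funext x; exact Real.sqrt_sq_eq_abs _
    rw [hs_eq] at h
    rw [ha]; exact h
  -- log-sum on `S`
  have hSb0 : 0 < ∑ k ∈ S, b k ^ 2 := Finset.sum_pos (fun k hk => pow_pos (hbpos k hk) 2) hSne
  have hSbB : ∑ k ∈ S, b k ^ 2 ≤ B := by
    calc ∑ k ∈ S, b k ^ 2 ≤ ∑ k : Fin n, b k ^ 2 :=
          Finset.sum_le_sum_of_subset_of_nonneg (Finset.filter_subset _ _) fun k _ _ => sq_nonneg _
      _ ≤ B := by
          rw [hBdef]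
          refine Finset.sum_le_sum fun k _ => pow_le_pow_left₀ (hb0 k) ?_ 2
          rw [hb]; exact Ep_abs_dk_le hp0.le hp1.le k g
  have hlogsum := sum_mul_log_div_ge S (fun k hk => (Finset.mem_filter.1 hk).2) (fun k hk => pow_pos (hbpos k hk) 2) hSne
  rw [hSa] at hlogsum
  -- monotonicity of `log`
  have hmono : V * Real.log (V / B) ≤ V * Real.log (V / ∑ k ∈ S, b k ^ 2) := by
    refine mul_le_mul_of_nonneg_left (Real.log_le_log (div_pos hV hB) ?_) hV.le
    exact div_le_div_of_nonneg_left hV.le hSb0 hSbB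
  calc V * Real.log (V / B) ≤ V * Real.log (V / ∑ k ∈ S, b k ^ 2) := hmono
    _ ≤ ∑ k ∈ S, a k * Real.log (a k / b k ^ 2) := hlogsum
    _ ≤ ∑ k ∈ S, Ent p (fun x => dk p k g x ^ 2) := Finset.sum_le_sum hlow
    _ ≤ ∑ k : Fin n, Ent p (fun x => dk p k g x ^ 2) :=
        Finset.sum_le_sum_of_subset_of_nonneg (Finset.filter_subset _ _) fun k _ _ => Ent_sq_nonneg hp0 hp1 _
    _ ≤ 2 / (p * (1 - p)) * E := hEnt

/-! ## Boolean increasing functions: the sharp-threshold inequality with pivotality probabilities -/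

/-- The pivotality indicator of the `i`-th bit for a `{0,1}`-valued increasing `g`:
`g(x^{i,1}) − g(x^{i,0})`. [cite: Talagrand1994, §1 (influences)] -/
def piv (i : Fin n) (g : (Fin n → Bool) → ℝ) (x : Fin n → Bool) : ℝ :=
  g (Function.update x i true) - g (Function.update x i false)

/-- For a `{0,1}`-valued increasing `g`, the pivotality indicator is `{0,1}`-valued. [folklore] -/
theorem piv_eq_zero_or_one {g : (Fin n → Bool) → ℝ} (hbool : ∀ x, g x = 0 ∨ g x = 1)
    (hmono : ∀ x i, g (Function.update x i false) ≤ g (Function.update x i true)) (i : Fin n) (x : Fin n → Bool) :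
    piv i g x = 0 ∨ piv i g x = 1 := by
  unfold piv
  have h := hmono x i
  rcases hbool (Function.update x i true) with h1 | h1 <;> rcases hbool (Function.update x i false) with h0 | h0
  · left; rw [h1, h0]; norm_num
  · exfalso; rw [h1, h0] at h; norm_num at h
  · right; rw [h1, h0]; norm_num
  · left; rw [h1, h0]; norm_num

/-- **Talagrand-type sharp-threshold inequality on the biased cube** (Rossignol 2006, Thm 2.1 /
Talagrand 1994, Thm 1.1, in the raw form produced by the log-Sobolev route): for `0 < p < 1` and a
`{0,1}`-valued increasing `g` on `{0,1}^n` with mean `t = E_p[g]` and pivotality probabilities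
`I_i = E_p[g(x^{i,1}) − g(x^{i,0})]`, if `0 < t(1−t)` and `Σ I_i² > 0` then
`t(1−t) · log( t(1−t) / (4p²(1−p)² Σ_i I_i²) ) ≤ 2 Σ_i I_i`.
(By Russo's formula `Σ I_i = d E_p[g]/dp`; with `Σ I_i² ≤ (max I_i)(Σ I_i)` this is
`f' ≥ ½ f(1−f)[log(1/max_i I_i) + log(1/f') + log(f(1−f)) − log(4p²(1−p)²)]`.)
[cite: Rossignol2006, Thm 2.1] [cite: Talagrand1994, Thm 1.1 and Cor 1.2] -/
theorem sharpThreshold_indicator {p : ℝ} (hp0 : 0 < p) (hp1 : p < 1) {g : (Fin n → Bool) → ℝ}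
    (hbool : ∀ x, g x = 0 ∨ g x = 1) (hmono : ∀ x i, g (Function.update x i false) ≤ g (Function.update x i true))
    (ht : 0 < Ep p g * (1 - Ep p g)) (hI : 0 < ∑ i : Fin n, Ep p (piv i g) ^ 2) :
    Ep p g * (1 - Ep p g) * Real.log (Ep p g * (1 - Ep p g) / (4 * p ^ 2 * (1 - p) ^ 2 * ∑ i : Fin n, Ep p (piv i g) ^ 2)) ≤
      2 * ∑ i : Fin n, Ep p (piv i g) := by
  have hpq : 0 < p * (1 - p) := mul_pos hp0 (by linarith)
  -- `g² = g`, `piv² = piv = |piv|`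
  have hsq : ∀ x, g x ^ 2 = g x := fun x => by rcases hbool x with h | h <;> rw [h] <;> norm_num
  have hpiv : ∀ i x, piv i g x ^ 2 = piv i g x ∧ |piv i g x| = piv i g x := fun i x => by
    rcases piv_eq_zero_or_one hbool hmono i x with h | h <;> rw [h] <;> norm_num
  -- the variance
  have hV : Ep p (fun x => (g x - Ep p g) ^ 2) = Ep p g * (1 - Ep p g) := by
    have hexp : (fun x => (g x - Ep p g) ^ 2) = fun x => (1 - 2 * Ep p g) * g x + Ep p g ^ 2 := by
      funext x; rw [sub_sq, hsq x]; ring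
    rw [hexp, Ep_add, Ep_smul, Ep_const]; ring
  -- the gradient norms
  have hE : ∀ i, Ep p (fun x => D p i g x ^ 2) = p * (1 - p) * Ep p (piv i g) := by
    intro i
    rw [Ep_D_sq, sqDiff]
    congr 1
    show Ep p (fun x => piv i g x ^ 2) = Ep p (piv i g)
    congr 1; funext x; exact (hpiv i x).1
  have hB : ∀ i, Ep p (fun x => |D p i g x|) = 2 * p * (1 - p) * Ep p (piv i g) := by
    intro i
    rw [Ep_abs_D hp0.le hp1.le]
    congr 1
    show Ep p (fun x => |piv i g x|) = Ep p (piv i g)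
    congr 1; funext x; exact (hpiv i x).2
  -- apply the main inequality
  have hVpos : 0 < Ep p (fun x => (g x - Ep p g) ^ 2) := by rw [hV]; exact ht
  have hBsum : ∑ k : Fin n, (Ep p fun x => |D p k g x|) ^ 2 = 4 * p ^ 2 * (1 - p) ^ 2 * ∑ i : Fin n, Ep p (piv i g) ^ 2 := by
    rw [Finset.mul_sum]; refine Finset.sum_congr rfl fun i _ => ?_; rw [hB]; ring
  have hBpos : 0 < ∑ k : Fin n, (Ep p fun x => |D p k g x|) ^ 2 := by rw [hBsum]; positivity
  have hEsum : ∑ k : Fin n, Ep p (fun x => D p k g x ^ 2) = p * (1 - p) * ∑ i : Fin n, Ep p (piv i g) := by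
    rw [Finset.mul_sum]; exact Finset.sum_congr rfl fun i _ => hE i
  have h := var_mul_log_le hp0 hp1 g hVpos hBpos
  rw [hV, hBsum, hEsum] at h
  have hconst : 2 / (p * (1 - p)) * (p * (1 - p) * ∑ i : Fin n, Ep p (piv i g)) = 2 * ∑ i : Fin n, Ep p (piv i g) := by
    rw [← mul_assoc, div_mul_cancel₀ _ hpq.ne']
  linarith [hconst]

end BiasedCube

end Literature.Probability.Moments

end
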